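import Literature.Computability.AlgebraicComplexity.ValiantCriterion
import Literature.Computability.AlgebraicComplexity.ValiantHCCompleteness
import Literature.Computability.AlgebraicComplexity.DeterminantalComplexityProofs
import Literature.Computability.Complexity.CircuitEval
import Literature.Computability.Complexity.CircuitClassesProofs
import Literature.Computability.Complexity.HamMatrixCircuits
import HarnessLib

/-!
# Crux `Capture` (stmt-PneNP-2659) — the UNIVERSAL RAIL CIRCUIT-SUM: one `VNP` polynomial per `(n, ℓ)` whose
# rail specialisations are the generating functions of all circuits of description length `ℓ` on `n` inputs

Part 3 of the kernel-checked VALIANT BARRIER of the crux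
`Summit.PneNP.PneNP.Theses.ConvexRankGates.Capture` (route PneNP/ConvexRankGates; idea card
`Cruxes/Capture/Ideas/permanent-shadow-bridge.md`, ideator 4, §4 `CaptureOfSmallHC`; lead c6, 2026-08-17).

* `exists_cktSize_evalRails` — for every `n, ℓ` a `B₂`-program of polynomial size on the input blocks
  `x ∈ {0,1}ⁿ`, `y, y' ∈ {0,1}^ℓ` computing `[⟨x, y⟩ ∈ EvalLang] ∧ [y' = ¬y]`, where `EvalLang` is the tree's
  circuit-evaluation language (`CircuitEval.lean`: `⟨x, desc C⟩ ∈ EvalLang ↔ C(x) = 1`, in `P`, hence in `P/poly` by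
  `P_subset_PPoly_holds`; the universal circuit comes for free from `exists_cktSize_boolPair_of_mem_PPoly`).
* `isVNPFamily_evalRails` — the ℕ-indexed family of their circuit-sums (index `N ↦ (n, ℓ) = unpair N`) is in `VNP`
  over every commutative ring (Valiant's criterion `isVNPFamily_circuitSum`).
* `exists_hasDetRepr_evalRails` (registered sub-goal) — if over a field `F` the Hamiltonian-cycle family has
  polynomially bounded determinantal complexity, then (HC is `VNP`-complete over every field,
  `isPProjection_hcPoly_of_isVNPFamily`; determinantal representations pass to projections,
  `HasDetRepr.of_isProjection_holds`) every universal rail circuit-sum `circuitSum (Q n ℓ)` has an affine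
  determinantal representation of size `(n + ℓ + 2)^c` for ONE constant `c`.

With part 2 (rail substitution) and part 1 (support shadow) this gives one GRANK gate of polynomial dimension for
every monotone function with a polynomial `B₂`-circuit, i.e. `Capture` (assembly: `ConvexRankGatesCaptureValiantBarrier.lean`).
No new definitions. [folklore]
-/

namespace Summit.PneNP.PneNP.Theorems.Capture.ValiantBarrier

set_option linter.dupNamespace false -- `Summit.PneNP.PneNP.…`: summit = sub-problem (D-0017)

open Literature.Computability.Complexity Literature.Computability.AlgebraicComplexity MvPolynomial
open Literature.Computability.AlgebraicComplexity.ValiantCriterion (circuitSum)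
open Literature.Computability.AlgebraicComplexity.CircuitArith (toK)
open Literature.Computability.Complexity.CircEval (EvalLang desc)

/-! ## Arithmetic of polynomial bounds -/

/-- A p-bounded function of `N` is bounded by a pure power of `N + 2`. [folklore] -/
theorem exists_le_pow_of_isPBounded {t : ℕ → ℕ} (ht : IsPBounded t) : ∃ c : ℕ, ∀ N, t N ≤ (N + 2) ^ c := by
  obtain ⟨c, hc⟩ := ht
  refine ⟨c + 1, fun N => (hc N).trans ?_⟩
  have h1 : c ≤ (N + 2) ^ c := (Nat.lt_two_pow_self).le.trans (Nat.pow_le_pow_left (by omega) c)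
  calc N ^ c + c ≤ (N + 2) ^ c + (N + 2) ^ c :=
        Nat.add_le_add (Nat.pow_le_pow_left (by omega) c) h1
    _ = 2 * (N + 2) ^ c := by ring
    _ ≤ (N + 2) * (N + 2) ^ c := Nat.mul_le_mul_right _ (by omega)
    _ = (N + 2) ^ (c + 1) := by ring

/-! ## The universal rail circuits -/

/-- The rail checker `[∀ j, y'_j = ¬y_j]` on the last two blocks of `x·y·y'` costs `ℓ + (ℓ + 1)` gates over `B₂`
(one fan-in-2 gate per position, then a conjunction chain). [folklore] -/
theorem cktSize_railCheck (n ℓ : ℕ) :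
    CktSize B2 (fun (v : Fin (n + (ℓ + ℓ)) → Bool) (_ : Unit) =>
      decide (∀ j : Fin ℓ, v (Fin.natAdd n (Fin.natAdd ℓ j)) = !v (Fin.natAdd n (Fin.castAdd ℓ j))))
      (ℓ * 1 + (ℓ + 1)) := by
  have hbit : ∀ j : Fin ℓ, CktSize B2 (fun (v : Fin (n + (ℓ + ℓ)) → Bool) (_ : Unit) =>
      decide (v (Fin.natAdd n (Fin.natAdd ℓ j)) = !v (Fin.natAdd n (Fin.castAdd ℓ j)))) 1 := fun j =>
    (CktSize.gate (B := B2) ⟨2, fun p => decide (p 0 = !p 1)⟩ (by show (2 : ℕ) ≤ 2; exact le_rfl)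
      ![Fin.natAdd n (Fin.natAdd ℓ j), Fin.natAdd n (Fin.castAdd ℓ j)]).congr fun v _ => rfl
  have h1 := CktSize.pi_const (f := fun (v : Fin (n + (ℓ + ℓ)) → Bool) (j : Fin ℓ) =>
      decide (v (Fin.natAdd n (Fin.natAdd ℓ j)) = !v (Fin.natAdd n (Fin.castAdd ℓ j)))) hbit
  have h2 := h1.comp (HamMatrix.cktSize_all ℓ)
  refine (h2.congr fun v _ => ?_).of_le (by simp)
  simp only [decide_eq_true_eq]

/-- **The universal rail circuits.** For every `n, ℓ` there is a `B₂`-circuit `Q` on `n + (ℓ + ℓ)` inputs,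
of size polynomial in `n + ℓ`, with `Q(x·y·y') = [⟨x, y⟩ ∈ EvalLang] ∧ [y' = ¬y]` (`⟨·,·⟩ = boolPair`). Ingredients:
`EvalLang ∈ P ⊆ P/poly` (`EvalLang_mem_P`, `P_subset_PPoly_holds`), the paired-input circuit
`exists_cktSize_boolPair_of_mem_PPoly`, and the rail checker. [folklore] -/
theorem exists_cktSize_evalRails : ∃ q : Polynomial ℕ, ∀ n ℓ : ℕ,
    CktSize B2 (fun (v : Fin (n + (ℓ + ℓ)) → Bool) (_ : Unit) =>
      (EvalLang.boolIndicator (boolPair (List.ofFn fun i : Fin n => v (Fin.castAdd (ℓ + ℓ) i))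
          (List.ofFn fun j : Fin ℓ => v (Fin.natAdd n (Fin.castAdd ℓ j)))) &&
        decide (∀ j : Fin ℓ, v (Fin.natAdd n (Fin.natAdd ℓ j)) = !v (Fin.natAdd n (Fin.castAdd ℓ j)))))
      ((2 * n + 2 + ℓ) + q.eval (2 * n + 2 + ℓ) + (ℓ * 1 + (ℓ + 1)) + 1) := by
  obtain ⟨q, hq⟩ := exists_cktSize_boolPair_of_mem_PPoly (P_subset_PPoly_holds CircEval.EvalLang_mem_P)
  refine ⟨q, fun n ℓ => ?_⟩
  have h1 := (hq n ℓ).rewire (ι' := Fin (n + (ℓ + ℓ)))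
    (Sum.elim (fun i => Fin.castAdd (ℓ + ℓ) i) (fun j => Fin.natAdd n (Fin.castAdd ℓ j)))
  have h2 := (h1.pair (cktSize_railCheck n ℓ)).comp (cktSize_and (Sum.inl ()) (Sum.inr ()))
  exact h2.congr fun v _ => rfl

/-- Transport of `CircuitFamily`-style evaluation along `|ofFn x| = n`: the evaluator accepts `⟨ofFn x, desc C⟩`
iff `C(x) = 1`, for a `B₂`-circuit `C` on `Fin n` (`evalFn_boolPair_desc`). [folklore] -/
theorem boolIndicator_evalLang_ofFn {n : ℕ} (C : Circuit (Fin n)) (hC : C.IsOver B2) (x : Fin n → Bool) :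
    EvalLang.boolIndicator (boolPair (List.ofFn x) (desc C)) = C.eval x := by
  have key : ∀ (w : List Bool) (m : ℕ) (hw : w.length = m) (D : Circuit (Fin m)), D.IsOver B2 →
      EvalLang.boolIndicator (boolPair w (desc D)) = D.eval (fun i => w.get (i.cast hw.symm)) := by
    rintro w _ rfl D hD
    have har : ∀ g ∈ D.gates, g.arity ≤ 2 := fun g hg => hD g hg
    have h := CircEval.evalFn_boolPair_desc w D har
    show EvalLang.boolIndicator (boolPair w (desc D)) = D.eval w.get
    cases hval : D.eval w.get with
    | true =>
      rw [hval] at h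
      exact (Set.mem_iff_boolIndicator _ _).1 (show boolPair w (desc D) ∈ EvalLang from h)
    | false =>
      rw [hval] at h
      refine Bool.eq_false_iff.2 fun hb => ?_
      have hmem : boolPair w (desc D) ∈ EvalLang := (Set.mem_iff_boolIndicator _ _).2 hb
      have h' : CircEval.evalFn (boolPair w (desc D)) = [true] := hmem
      rw [h] at h'
      simp at h'
  have := key (List.ofFn x) n (List.length_ofFn ..) C hC
  rw [this]
  congr 1
  funext i
  simp

/-! ## Valiant's criterion and completeness of `HC`: determinantal representations of the universal sums -/

/-- The components of `unpair N` are p-bounded in `N`. [folklore] -/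
theorem isPBounded_unpair_fst : IsPBounded fun N => (Nat.unpair N).1 :=
  IsPBounded.id.mono fun N => Nat.unpair_left_le N

/-- The components of `unpair N` are p-bounded in `N`. [folklore] -/
theorem isPBounded_unpair_snd : IsPBounded fun N => (Nat.unpair N).2 :=
  IsPBounded.id.mono fun N => Nat.unpair_right_le N

/-- `pair n ℓ + 2 ≤ (n + ℓ + 2)²`. [folklore] -/
theorem pair_add_two_le_sq (n ℓ : ℕ) : Nat.pair n ℓ + 2 ≤ (n + ℓ + 2) ^ 2 := by
  have h1 : Nat.pair n ℓ < (max n ℓ + 1) ^ 2 := Nat.pair_lt_max_add_one_sq n ℓ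
  have h2 : max n ℓ + 1 ≤ n + ℓ + 1 := by omega
  have h3 : (max n ℓ + 1) ^ 2 ≤ (n + ℓ + 1) ^ 2 := Nat.pow_le_pow_left h2 2
  nlinarith

/-- **Universal rail circuit-sums have polynomial determinantal complexity if `HC` does** (registered sub-goal
`exists_hasDetRepr_evalRails` of the Valiant barrier). If over the field `F` the Hamiltonian-cycle family
`(HC_m)` has p-bounded determinantal complexity, then there are one constant `c` and universal rail circuits
`Q n ℓ` (on `x·y·y' ∈ {0,1}^{n+ℓ+ℓ}`, computing `[⟨x,y⟩ ∈ EvalLang] ∧ [y' = ¬y]`) whose circuit-sums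
`circuitSum (Q n ℓ)` all have affine determinantal representations of size `(n + ℓ + 2)^c`. Chain: Valiant's
criterion (`isVNPFamily_circuitSum`) puts the ℕ-indexed family (index `N ↦ (n, ℓ) = unpair N`) in `VNP`; `HC` is
`VNP`-complete over every field (`isPProjection_hcPoly_of_isVNPFamily`), so each member is a projection of some
`HC_{t N}` with `t` p-bounded; determinantal representations pass to projections (`HasDetRepr.of_isProjection_holds`)
and pad (`HasDetRepr.mono_holds`). [folklore] -/
theorem exists_hasDetRepr_evalRails : ∀ (F : Type) [Field F],
    IsPBounded (fun m => Literature.Computability.AlgebraicComplexity.determinantalComplexity (hcPoly (Fin m) F)) →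
    ∃ (c : ℕ) (Q : ∀ n ℓ : ℕ, Circuit (Fin (n + (ℓ + ℓ)))),
      (∀ n ℓ, HasDetRepr (ValiantCriterion.circuitSum (k := F) (Q n ℓ)) ((n + ℓ + 2) ^ c)) ∧
      ∀ (n ℓ : ℕ) (x : Fin n → Bool) (y y' : Fin ℓ → Bool),
        (Q n ℓ).eval (Fin.append x (Fin.append y y')) =
          (CircEval.EvalLang.boolIndicator (boolPair (List.ofFn x) (List.ofFn y)) &&
            decide (∀ j, y' j = !y j)) := by
  intro F _ hF
  obtain ⟨q, hq⟩ := exists_cktSize_evalRails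
  choose Q hQB hQs hQe using fun n ℓ => (hq n ℓ).toCircuit
  -- p-bounded bookkeeping along `N ↦ (n, ℓ) = unpair N`
  have hT : IsPBounded fun N => 2 * (Nat.unpair N).1 + 2 + (Nat.unpair N).2 :=
    IsPBounded.add_holds (IsPBounded.add_holds (IsPBounded.mul_holds (IsPBounded.const 2)
      isPBounded_unpair_fst) (IsPBounded.const 2)) isPBounded_unpair_snd
  have hq_pb : IsPBounded fun M => q.eval M :=
    (isPBounded_iff_exists_polynomial_holds _).2 ⟨q, fun _ => le_rfl⟩
  have hvars : IsPBounded fun N => (Nat.unpair N).1 + ((Nat.unpair N).2 + (Nat.unpair N).2) :=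
    IsPBounded.add_holds isPBounded_unpair_fst (IsPBounded.add_holds isPBounded_unpair_snd isPBounded_unpair_snd)
  have hsize : IsPBounded fun N => (Q (Nat.unpair N).1 (Nat.unpair N).2).size := by
    refine (IsPBounded.add_holds (IsPBounded.add_holds (IsPBounded.add_holds hT (IsPBounded.comp_holds hq_pb hT))
      (IsPBounded.add_holds (IsPBounded.mul_holds isPBounded_unpair_snd (IsPBounded.const 1))
        (IsPBounded.add_holds isPBounded_unpair_snd (IsPBounded.const 1)))) (IsPBounded.const 1)).mono
      fun N => ?_
    exact hQs _ _
  -- Valiant's criterion: the family of circuit-sums is in VNP over `F`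
  have hVNP := isVNPFamily_circuitSum (k := F) hvars (fun N => Q (Nat.unpair N).1 (Nat.unpair N).2)
    (fun N => hQB _ _) hsize
  -- `HC` is VNP-complete over every field: p-projection of `HC_{t N}`
  obtain ⟨t, ht, hproj⟩ := isPProjection_hcPoly_of_isVNPFamily F _ hVNP
  -- determinantal representations of the right size
  have hD : IsPBounded fun N => Literature.Computability.AlgebraicComplexity.determinantalComplexity
      (hcPoly (Fin (t N)) F) := IsPBounded.comp_holds hF ht
  obtain ⟨c₂, hc₂⟩ := exists_le_pow_of_isPBounded hD
  refine ⟨2 * c₂, Q, fun n ℓ => ?_, fun n ℓ x y y' => ?_⟩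
  · have h1 : HasDetRepr (circuitSum (k := F) (Q (Nat.unpair (Nat.pair n ℓ)).1 (Nat.unpair (Nat.pair n ℓ)).2))
        ((Nat.pair n ℓ + 2) ^ c₂) :=
      HasDetRepr.mono_holds (HasDetRepr.of_isProjection_holds
        (hasDetRepr_determinantalComplexity_holds (hcPoly (Fin (t (Nat.pair n ℓ))) F)) (hproj (Nat.pair n ℓ)))
        (hc₂ (Nat.pair n ℓ))
    rw [Nat.unpair_pair] at h1
    refine HasDetRepr.mono_holds h1 ?_
    rw [pow_mul]
    exact Nat.pow_le_pow_left (pair_add_two_le_sq n ℓ) c₂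
  · rw [hQe]
    simp only [Fin.append_left, Fin.append_right]

end Summit.PneNP.PneNP.Theorems.Capture.ValiantBarrier
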